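/-
COR-CM (cell pub-hodgecm2) — RSCONJ row Ω (A7, the ω-LABEL face of `μ ↦ μᶜ`), ROUTE C (`HOME/d2bridge/ident/ident-1/omega/OMEGA-ROUTE-C.md`
§3 (C3′)(i), §6): THE LABEL of the θ-twisted splitting family.  Seat prover-pub-hodgecm2-mukey-p1-g2-0 (mukey-p1 GEN 2, second pen under
ident-1 g3's spec; checker ident-2).  KERNEL ONLY: theorems; no definition, no named fact, no instance, no `sorry`.  HC_CM is NOT proved;
HELD — WORLD = C FINAL; nothing displayed by an END is discharged here.
-/
import Summits.HodgeConjecture.CorCM.B01.Transposition.HComp.RecordSystemConjOmegaTwistCompatible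
import Summits.HodgeConjecture.CorCM.B01.Transposition.Item6OmegaChiSplitting
import Literature.NumberTheory.GelbartRogawski1991.DoubledWeilRepresentationRelabel
import Literature.NumberTheory.GelbartRogawski1991.DoubledWeilRepresentationUndoublingConj
import Literature.NumberTheory.Automorphic.IdeleClassCharacterConjugate
import HarnessLib

set_option autoImplicit false

/-!
# The θ-twist of the unitary dual-pair Weil carriers: THE LABEL `conjFamily (sChiD χ) = sChiD (χ ∘ c)`

For a CM field `F` (`c` = complex conjugation, `F⁺` its maximal real subfield), a real non-degenerate diagonal frame
`dV : Fin 3 → F` with index equivalence `e : Fin 3 × Fin 1 ≃ Fin n`, and a unitary splitting character `χ` (`χ.IsUnitary`,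
`IsSplittingChar F 1 χ`), the θ-TWISTED family `conjFamily s a = R_a ∘ s_{−a} ∘ (g ↦ ḡ)` (✔ `HComp.RecordSystemConjOmegaTwistCompatible`)
of the [GR91]-splitting family ATTACHED TO `χ` (`sChiD … χ …`, ✔ `Item6OmegaChiSplitting`: the undoubling of the `χ`-normalised doubled
Weil representation, read on the line `⟨a⟩`) IS the family attached to the conjugate character `χ ∘ c = galConj c χ`:

**`conjFamily F⁺ F c 3 e (diagonal dV) _ (sChiD F e dV hdV hdV0 χ hχu hχs) = sChiD F e dV hdV hdV0 (galConj c χ) _ _`** (`conjFamily_sChiD_family`;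
pointwise `conjFamily_sChiD`; target-flexible `conjFamily_sChiD_of_eq`; at `χ = μ` viewed as a Hecke character, `(toHeckeCharacter μ) ∘ c =
toHeckeCharacter μᶜ` by ✔ `toHeckeCharacter_galConj`: `conjFamily_sChiD_toHeckeCharacter`).

Proof (route (i) of the memo): at the DOUBLED level the twist `R^𝔻 ∘ s^𝔻_χ ∘ (h ↦ h̄)` of the `χ`-normalised doubled Weil representation at the
line `−a` is a `(χ ∘ c)`-normalised doubled Weil representation at the line `a` (✔-desk `isDoubledWeilRep_relabel_comp_conjH`: `det_Δ(p̄) = c(det_Δ p)`,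
`Λ` normalises the Siegel parabolic, `r(δ)` is Θ-rigid); undoubling commutes with the twist (✔-desk `undoubleHom_relabel_comp_conjH`, by
✔ `undouble_unique`); `sChiD` is choice-free (✔ `sChiD_eq_splittingCongr_undoubleHom`); and the `splittingCongr` casts from the diagonal data
`(diag dV, diag (lineW (TW (±a))))` to the line data `(diag dV, JW (±a))` commute with `R`, `(g ↦ ḡ)` (§1, by `subst`).

References: [GelbartRogawski1991] §3.1 Prop. 3.1.1 p. 455, Remark p. 457; [Kudla1994] §2, Thm. 3.1; [HarrisKudlaSweet1996] §1 (1.14)–(1.15);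
[MoeglinVignerasWaldspurger1987] Chap. 2 II.1; [Kudla1996] V.3; [Liu2021] Def. 4.11, App. D §D.1.
-/

noncomputable section

open scoped Matrix Kronecker
open NumberField IsDedekindDomain
open Literature.RepresentationTheory.HeisenbergGroup
open Literature.NumberTheory.Automorphic Literature.NumberTheory.Automorphic.UnitaryGroup
open Literature.NumberTheory.Automorphic.IdeleClassGroup (toHeckeCharacter toHeckeCharacter_galConj)
open Literature.NumberTheory.Weil1964
open Literature.NumberTheory.GaloisRepresentations Literature.NumberTheory.GaloisRepresentations.HeckeCharacter
open Literature.NumberTheory.GelbartRogawski1991 Literature.NumberTheory.GelbartRogawski1991.UnitaryDualPair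
open Literature.NumberTheory.GelbartRogawski1991.GRConstruction
open Literature.RepresentationTheory.HarrisKudlaSweet1996 (IsSplittingChar)
open Literature.NumberTheory.Automorphic.Liu2021.Def411WeilCarriersDoubling
open Literature.NumberTheory.Automorphic.Liu2021.Def411WeilCarriers (TW JW JW_eq isSymm_TW isUnit_det_TW)
open Summit.HodgeConjecture.CorCM.Transposition.OmegaChiSplitting (sChiD sChiD_eq_splittingCongr_undoubleHom)

namespace Summit.HodgeConjecture.CorCM.HComp.OmegaConj

/-! ## §1 The `splittingCongr` casts commute with a relabelling on the left and a matrix-given group map on the right -/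

section Casts

variable (F E : Type) [Field F] [NumberField F] [Field E] [NumberField E] [Algebra F E]
variable (c : E ≃ₐ[F] E) (N M : ℕ) {n : ℕ} (e : Fin N × Fin M ≃ Fin n)
variable (JV : Matrix (Fin N) (Fin N) E) {TV : Matrix (Fin N) (Fin N) F}
variable {TW₁ TW₁' TW₂ TW₂' : Matrix (Fin M) (Fin M) F} {JW₁ JW₁' JW₂ JW₂' : Matrix (Fin M) (Fin M) E}

/-- **cast bookkeeping**: transporting `R ∘ s ∘ θ` along equal W-data `(T₂, J₂) = (T₂′, J₂′)` is `R ∘ (transport of s along (T₁, J₁) = (T₁′, J₁′)) ∘ θ′`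
for the relabelling `R = adelicMpContRelabel C` (any two proofs of its Gram identity) and group maps `θ`, `θ′` given by the SAME function on
`GL`-matrices (by `subst`: all four casts are identities). [cite: GelbartRogawski1991, §3.1 Prop. 3.1.1 p. 455 L1–3; Remark p. 457 L4] -/
theorem splittingCongr_relabel_comp_comp (hT₁ : TW₁ = TW₁') (hJ₁ : JW₁ = JW₁') (hT₂ : TW₂ = TW₂') (hJ₂ : JW₂ = JW₂')
    (C : GL (Fin n) (AdeleRing (𝓞 F) F))
    (hC : adelicGram F e TV TW₂ * (C : Matrix (Fin n) (Fin n) (AdeleRing (𝓞 F) F)) = adelicGram F e TV TW₁)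
    (hC' : adelicGram F e TV TW₂' * (C : Matrix (Fin n) (Fin n) (AdeleRing (𝓞 F) F)) = adelicGram F e TV TW₁')
    (s : adelicPair F E c N M JV JW₁ →* adelicMpCont F (Fin n) (adelicGram F e TV TW₁))
    (θ : adelicPair F E c N M JV JW₂ →* adelicPair F E c N M JV JW₁) (θ' : adelicPair F E c N M JV JW₂' →* adelicPair F E c N M JV JW₁')
    (f : GL (Fin N × Fin M) (AdeleRing (𝓞 E) E) → GL (Fin N × Fin M) (AdeleRing (𝓞 E) E))
    (hθ : ∀ g, ((θ g : adelicPair F E c N M JV JW₁) : GL (Fin N × Fin M) (AdeleRing (𝓞 E) E)) =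
      f (g : GL (Fin N × Fin M) (AdeleRing (𝓞 E) E)))
    (hθ' : ∀ g, ((θ' g : adelicPair F E c N M JV JW₁') : GL (Fin N × Fin M) (AdeleRing (𝓞 E) E)) =
      f (g : GL (Fin N × Fin M) (AdeleRing (𝓞 E) E))) :
    splittingCongr F E c N M e JV hT₂ hJ₂ (((adelicMpContRelabel F (Fin n) C hC).toMonoidHom.comp s).comp θ) =
      ((adelicMpContRelabel F (Fin n) C hC').toMonoidHom.comp (splittingCongr F E c N M e JV hT₁ hJ₁ s)).comp θ' := by
  subst hT₁ hJ₁ hT₂ hJ₂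
  have hθθ : θ = θ' := MonoidHom.ext fun g => Subtype.ext ((hθ g).trans (hθ' g).symm)
  subst hθθ
  rfl

end Casts

/-! ## §2 `χ ∘ c` is again a unitary splitting character -/

section Chi

variable (F : CMField)

/-- `χ ∘ c` is unitary if `χ` is. [folklore] -/
theorem isUnitary_galConj {χ : HeckeCharacter F} (hχu : χ.IsUnitary) : (galConj (IsCMField.complexConj F) χ).IsUnitary :=
  fun x => by rw [galConj_apply]; exact hχu _

/-- `χ ∘ c` satisfies the splitting condition `χ|_{𝕀_{F⁺}} = ε^m` if `χ` does (`c` fixes the `F⁺`-idèles, ✔ `AdeleRing.smul_ideleBaseChange`).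
[cite: HarrisKudlaSweet1996, (1.5) p. 951] -/
theorem isSplittingChar_galConj {m : ℕ} {χ : HeckeCharacter F} (hχs : IsSplittingChar F m χ) :
    IsSplittingChar F m (galConj (IsCMField.complexConj F) χ) :=
  fun x => by rw [galConj_apply, AdeleRing.smul_ideleBaseChange]; exact hχs x

end Chi

/-! ## §3 THE LABEL -/

section Label

variable (F : CMField) {n : ℕ} (e : Fin 3 × Fin 1 ≃ Fin n) (dV : Fin 3 → F)
  (hdV : ∀ i, IsCMField.complexConj F (dV i) = dV i) (hdV0 : ∀ i, dV i ≠ 0)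
  (χ : HeckeCharacter F) (hχu : χ.IsUnitary) (hχs : IsSplittingChar F 1 χ)

/-- **THE LABEL, pointwise: `conjFamily (sChiD χ) a = sChiD (χ ∘ c) a`** — the θ-twist `R_a ∘ sChiD χ (−a) ∘ (g ↦ ḡ)` of the splitting attached
to `χ` IS the splitting attached to `χ ∘ c` at the line `⟨a⟩`.  Doubling normalisation under `c` (✔-desk `isDoubledWeilRep_relabel_comp_conjH`),
undoubling commutes with the twist (✔-desk `undoubleHom_relabel_comp_conjH`), choice-freeness of `sChiD` (✔ `sChiD_eq_splittingCongr_undoubleHom`)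
at `a`, and the casts of §1 (`hneg : TW (−a) = −TW a`, ✔ `realDiagonal_lineW`, ✔ `TW_neg`).
[cite: GelbartRogawski1991, §3.1 Prop. 3.1.1 p. 455 L1–3 and §3.2 Remark p. 457] [cite: HarrisKudlaSweet1996, §1 (1.14)–(1.15)]
[cite: Kudla1994, §2 (doubled space, Siegel parabolic), Thm. 3.1] -/
theorem conjFamily_sChiD (a : (Fp F)ˣ) :
    conjFamily (Fp F) F (IsCMField.complexConj F) 3 e (Matrix.diagonal dV) (realDiagonal_map F dV hdV).symm
        (sChiD F e dV hdV hdV0 χ hχu hχs) a =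
      sChiD F e dV hdV hdV0 (galConj (IsCMField.complexConj F) χ) (isUnitary_galConj F hχu) (isSplittingChar_galConj F hχs) a := by
  -- the line data at `∓a`: source `dW := lineW (TW (−a))`, target `dW′ := lineW (TW a)`
  have hneg : realDiagonal F (lineW F (TW (Fp F) (-a))) (complexConj_lineW F (TW (Fp F) (-a))) =
      -realDiagonal F (lineW F (TW (Fp F) a)) (complexConj_lineW F (TW (Fp F) a)) := by
    rw [realDiagonal_lineW, realDiagonal_lineW, TW_neg]
  -- the `χ`-normalised doubled Weil representation at `−a` and its twist, a `(χ ∘ c)`-normalised one at `a`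
  have hsD := isDoubledWeilRep_doubledWeilRep F e dV hdV hdV0 (lineW F (TW (Fp F) (-a))) (complexConj_lineW F (TW (Fp F) (-a)))
    (lineW_ne_zero F (TW (Fp F) (-a)) (isUnit_det_TW (Fp F) (-a))) χ hχu hχs
  have h' := isDoubledWeilRep_relabel_comp_conjH (e := e) (dV := dV) (hdV := hdV) hdV0
    (lineW_ne_zero F (TW (Fp F) (-a)) (isUnit_det_TW (Fp F) (-a))) (lineW_ne_zero F (TW (Fp F) a) (isUnit_det_TW (Fp F) a)) hneg χ hsD
  -- choice-freeness at `a` for `χ ∘ c`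
  have e1 := sChiD_eq_splittingCongr_undoubleHom F e dV hdV hdV0 (galConj (IsCMField.complexConj F) χ) (isUnitary_galConj F hχu)
    (isSplittingChar_galConj F hχs) a h'
  -- undoubling commutes with the twist
  have e2 := undoubleHom_relabel_comp_conjH (e := e) (dV := dV) (hdV := hdV) hdV0
    (lineW_ne_zero F (TW (Fp F) (-a)) (isUnit_det_TW (Fp F) (-a))) (lineW_ne_zero F (TW (Fp F) a) (isUnit_det_TW (Fp F) a)) hneg
    hsD.proj_eq h'.proj_eq
  -- the casts
  have e3 := splittingCongr_relabel_comp_comp (Fp F) F (IsCMField.complexConj F) 3 1 e (Matrix.diagonal dV) (TV := realDiagonal F dV hdV)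
    (realDiagonal_lineW F (TW (Fp F) (-a))) (diagonal_lineW F (TW (Fp F) (-a)) (JW_eq (Fp F) F (-a)))
    (realDiagonal_lineW F (TW (Fp F) a)) (diagonal_lineW F (TW (Fp F) a) (JW_eq (Fp F) F a)) (-1)
    (gramA_mul_negOne (e := e) (dV := dV) (hdV := hdV) hneg) (adelicGram_mul_neg_one (Fp F) e (realDiagonal F dV hdV) a)
    (chiSplitting F e dV hdV hdV0 (lineW F (TW (Fp F) (-a))) (complexConj_lineW F (TW (Fp F) (-a)))
      (lineW_ne_zero F (TW (Fp F) (-a)) (isUnit_det_TW (Fp F) (-a))) χ hχu hχs)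
    (pairConjD (hdV := hdV) hneg)
    (pairConjNeg (Fp F) F (IsCMField.complexConj F) 3 (Matrix.diagonal dV) (realDiagonal_map F dV hdV).symm a)
    (Matrix.GeneralLinearGroup.map (conjAdele (Fp F) F (IsCMField.complexConj F)))
    (coe_pairConjD (hdV := hdV) hneg)
    (coe_pairConjNeg (Fp F) F (IsCMField.complexConj F) 3 (Matrix.diagonal dV) (realDiagonal_map F dV hdV).symm a)
  exact (e1.trans ((congrArg (splittingCongr (Fp F) F (IsCMField.complexConj F) 3 1 e (Matrix.diagonal dV)
    (realDiagonal_lineW F (TW (Fp F) a)) (diagonal_lineW F (TW (Fp F) a) (JW_eq (Fp F) F a))) e2).trans e3)).symm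

/-- **THE LABEL, as an equality of splitting FAMILIES** (the shape `h : s = s′` consumed by ✔-desk `omegaAtLineCongr`):
`conjFamily (sChiD χ) = sChiD (χ ∘ c)`. [cite: GelbartRogawski1991, §3.1 Prop. 3.1.1 p. 455 L1–3 and §3.2 Remark p. 457] -/
theorem conjFamily_sChiD_family :
    conjFamily (Fp F) F (IsCMField.complexConj F) 3 e (Matrix.diagonal dV) (realDiagonal_map F dV hdV).symm
        (sChiD F e dV hdV hdV0 χ hχu hχs) =
      sChiD F e dV hdV hdV0 (galConj (IsCMField.complexConj F) χ) (isUnitary_galConj F hχu) (isSplittingChar_galConj F hχs) :=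
  funext fun a => conjFamily_sChiD F e dV hdV hdV0 χ hχu hχs a

/-- **THE LABEL with a flexible target**: for ANY presentation `χ′ = χ ∘ c` of the conjugate character and ANY proofs `hχ′u`, `hχ′s`
(proof irrelevance), `conjFamily (sChiD χ) = sChiD χ′`. [cite: GelbartRogawski1991, §3.1 Prop. 3.1.1 p. 455 L1–3 and §3.2 Remark p. 457] -/
theorem conjFamily_sChiD_of_eq {χ' : HeckeCharacter F} (hχ' : galConj (IsCMField.complexConj F) χ = χ') (hχ'u : χ'.IsUnitary)
    (hχ's : IsSplittingChar F 1 χ') :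
    conjFamily (Fp F) F (IsCMField.complexConj F) 3 e (Matrix.diagonal dV) (realDiagonal_map F dV hdV).symm
        (sChiD F e dV hdV hdV0 χ hχu hχs) =
      sChiD F e dV hdV hdV0 χ' hχ'u hχ's := by
  subst hχ'
  exact conjFamily_sChiD_family F e dV hdV hdV0 χ hχu hχs

/-- **THE LABEL at `χ = μ` viewed as a Hecke character: `conjFamily (sChiD μ) = sChiD μᶜ`** — for a unitary idèle class character
`μ : C_F →ₜ* S¹`, `(toHeckeCharacter μ) ∘ c = toHeckeCharacter (μ ∘ c)` (✔ `toHeckeCharacter_galConj`), so the θ-twist of the family attached to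
`μ` is the family attached to `μᶜ = IdeleClassGroup.galConj c μ` (ANY proofs of its unitarity ∕ splitting condition).
[cite: GelbartRogawski1991, §3.1 Prop. 3.1.1 p. 455 L1–3 and §3.2 Remark p. 457] [cite: Liu2021, §4.1 (l. 1912)] -/
theorem conjFamily_sChiD_toHeckeCharacter (μ : IdeleClassGroup F →ₜ* Circle) (hμu : (toHeckeCharacter F μ).IsUnitary)
    (hμs : IsSplittingChar F 1 (toHeckeCharacter F μ))
    (hμ'u : (toHeckeCharacter F (IdeleClassGroup.galConj (IsCMField.complexConj F) μ)).IsUnitary)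
    (hμ's : IsSplittingChar F 1 (toHeckeCharacter F (IdeleClassGroup.galConj (IsCMField.complexConj F) μ))) :
    conjFamily (Fp F) F (IsCMField.complexConj F) 3 e (Matrix.diagonal dV) (realDiagonal_map F dV hdV).symm
        (sChiD F e dV hdV hdV0 (toHeckeCharacter F μ) hμu hμs) =
      sChiD F e dV hdV hdV0 (toHeckeCharacter F (IdeleClassGroup.galConj (IsCMField.complexConj F) μ)) hμ'u hμ's :=
  conjFamily_sChiD_of_eq F e dV hdV hdV0 (toHeckeCharacter F μ) hμu hμs
    (toHeckeCharacter_galConj (IsCMField.complexConj F) μ).symm hμ'u hμ's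

end Label

end Summit.HodgeConjecture.CorCM.HComp.OmegaConj

end
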